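import Literature.NumberTheory.DiophantineApproximation.KoksmaInequality
import Mathlib.Data.Fin.Tuple.Sort
import Mathlib.Tactic
import HarnessLib

/-!
# Order statistics of a point set with small box discrepancy (CDT Corollary 62)

Calegari–Dimitrov–Tang, arXiv:2408.15403, §6.2 Corollary 62 and its proof (pp. 49–50): if
`𝐭 = (t_1,…,t_d) ∈ [0,1]^d` has box discrepancy `D(𝐭) < ε` and `π` sorts the coordinates,
`t_{π(1)} ≤ ⋯ ≤ t_{π(d)}`, then the `j`-th order statistic is pinned near `j/d`: "the interval
`[0, n_{π(j)}]` contains at least the `j` elements `n_{π(1)},…,n_{π(j)}` … the definition of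
discrepancy mandates that it contains at most `n_{π(j)} d/((m+δ)D) + εd` of the components",
and symmetrically with `[n_{π(j)}, (m+δ)D]` (proof of eq. (6.11)); consequently partial sums
over rank windows and the total `Σ_j t_j` (eq. (6.12), (6.10), and the implication
`𝐭 ∈ P_ε^d ⟹ Σ t_j ∈ [d/2 − εd, d/2 + εd]` of the proof of eq. (6.9)) are pinned near their
equidistributed values. This file proves these facts for the box discrepancy `D` of
Definition 44 (`Discrepancy.boxDiscrepancy`), in normalised coordinates `𝐭 ∈ [0,1]^d`
(CDT apply them to `𝐭 = 𝐧/((m+δ)D)` and `𝐤/D`):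

* `orderStat_ge`, `orderStat_le` — `(j+1)/d − ε ≤ t_{π(j)} ≤ j/d + ε` (ranks `j = 0,…,d−1`);
* `abs_sum_orderStat_sub_le` — `|Σ_{j∈S} t_{π(j)} − Σ_{j∈S} (j+1)/d| ≤ ε·#S` for any set of
  ranks `S`;
* `abs_sum_sub_half_le` — `|Σ_j t_j − (d+1)/2| ≤ εd`.

No named facts.

## References

* [CalegariDimitrovTang2024] arXiv:2408.15403, §6.2 Corollary 62, eqs. (6.9)–(6.12) and proof
  (pp. 49–50); §4.1 Definition 44.
-/

noncomputable section

open Finset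

namespace Literature.NumberTheory.DiophantineApproximation

namespace Discrepancy

variable {d : ℕ}

/-- At least `j+1` coordinates lie in `[0, t_{π(j)}]`. [folklore] -/
theorem card_le_orderStat_ge (t : Fin d → ℝ) (ht0 : ∀ s, 0 ≤ t s) (j : Fin d) :
    (j : ℕ) + 1 ≤ (univ.filter fun s => 0 ≤ t s ∧ t s ≤ t (Tuple.sort t j)).card := by
  classical
  have hmono := Tuple.monotone_sort t
  calc (j : ℕ) + 1 = ((Finset.Iic j).image (Tuple.sort t)).card := by
        rw [Finset.card_image_of_injective _ (Tuple.sort t).injective, Fin.card_Iic]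
    _ ≤ (univ.filter fun s => 0 ≤ t s ∧ t s ≤ t (Tuple.sort t j)).card := by
        refine Finset.card_le_card fun s hs => ?_
        obtain ⟨i, hi, rfl⟩ := Finset.mem_image.mp hs
        rw [Finset.mem_Iic] at hi
        exact Finset.mem_filter.mpr ⟨mem_univ _, ht0 _, hmono hi⟩

/-- At least `d − j` coordinates lie in `[t_{π(j)}, 1]`. [folklore] -/
theorem card_ge_orderStat_ge (t : Fin d → ℝ) (ht1 : ∀ s, t s ≤ 1) (j : Fin d) :
    d - (j : ℕ) ≤ (univ.filter fun s => t (Tuple.sort t j) ≤ t s ∧ t s ≤ 1).card := by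
  classical
  have hmono := Tuple.monotone_sort t
  calc d - (j : ℕ) = ((Finset.Ici j).image (Tuple.sort t)).card := by
        rw [Finset.card_image_of_injective _ (Tuple.sort t).injective, Fin.card_Ici]
    _ ≤ (univ.filter fun s => t (Tuple.sort t j) ≤ t s ∧ t s ≤ 1).card := by
        refine Finset.card_le_card fun s hs => ?_
        obtain ⟨i, hi, rfl⟩ := Finset.mem_image.mp hs
        rw [Finset.mem_Ici] at hi
        exact Finset.mem_filter.mpr ⟨mem_univ _, hmono hi, ht1 _⟩

/-- **Lower pinning of order statistics** (CDT, proof of eq. (6.11)): `t_{π(j)} ≥ (j+1)/d − ε`.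
[cite: CalegariDimitrovTang2024, §6.2 proof of Corollary 62, eq. (6.11) lower bound (p. 50)] -/
theorem orderStat_ge (t : Fin d → ℝ) (ht0 : ∀ s, 0 ≤ t s) (ht1 : ∀ s, t s ≤ 1) {ε : ℝ}
    (hε : boxDiscrepancy t ≤ ε) (j : Fin d) :
    ((j : ℕ) + 1 : ℝ) / d - ε ≤ t (Tuple.sort t j) := by
  classical
  have hd : 0 < d := Fin.pos j
  have hdr : (0 : ℝ) < d := by exact_mod_cast hd
  set b := t (Tuple.sort t j) with hb
  have hb0 : 0 ≤ b := ht0 _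
  have hb1 : b ≤ 1 := ht1 _
  have hloc := (localDisc_le_boxDiscrepancy t le_rfl hb0 hb1).trans hε
  unfold localDisc at hloc
  have hcard : ((j : ℕ) + 1 : ℝ) ≤ ((univ.filter fun s => 0 ≤ t s ∧ t s ≤ b).card : ℝ) := by
    exact_mod_cast card_le_orderStat_ge t ht0 j
  have h1 := (abs_le.mp hloc).1
  have h2 : ((j : ℕ) + 1 : ℝ) / d ≤ ((univ.filter fun s => 0 ≤ t s ∧ t s ≤ b).card : ℝ) / d :=
    div_le_div_of_nonneg_right hcard hdr.le
  simp only [sub_zero] at h1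
  linarith

/-- **Upper pinning of order statistics** (CDT, proof of eq. (6.11)): `t_{π(j)} ≤ j/d + ε`.
[cite: CalegariDimitrovTang2024, §6.2 proof of Corollary 62, eq. (6.11) upper bound (p. 50)] -/
theorem orderStat_le (t : Fin d → ℝ) (ht0 : ∀ s, 0 ≤ t s) (ht1 : ∀ s, t s ≤ 1) {ε : ℝ}
    (hε : boxDiscrepancy t ≤ ε) (j : Fin d) :
    t (Tuple.sort t j) ≤ ((j : ℕ) : ℝ) / d + ε := by
  classical
  have hd : 0 < d := Fin.pos j
  have hdr : (0 : ℝ) < d := by exact_mod_cast hd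
  set a := t (Tuple.sort t j) with ha
  have ha0 : 0 ≤ a := ht0 _
  have ha1 : a ≤ 1 := ht1 _
  have hloc := (localDisc_le_boxDiscrepancy t ha0 ha1 le_rfl).trans hε
  unfold localDisc at hloc
  have hcard : ((d : ℕ) : ℝ) - (j : ℕ) ≤ ((univ.filter fun s => a ≤ t s ∧ t s ≤ 1).card : ℝ) := by
    have := card_ge_orderStat_ge t ht1 j
    have hj : (j : ℕ) ≤ d := j.isLt.le
    rw [← Nat.cast_sub hj]
    exact_mod_cast this
  have h1 := (abs_le.mp hloc).1
  have h2 : ((univ.filter fun s => a ≤ t s ∧ t s ≤ 1).card : ℝ) ≤ (1 - a + ε) * d := by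
    have : ((univ.filter fun s => a ≤ t s ∧ t s ≤ 1).card : ℝ) / d ≤ 1 - a + ε := by linarith
    rwa [div_le_iff₀ hdr] at this
  have h3 : ((d : ℕ) : ℝ) - (j : ℕ) ≤ (1 - a + ε) * d := hcard.trans h2
  have h4 : a * d ≤ (j : ℕ) + ε * d := by nlinarith [h3]
  rw [div_add' _ _ _ hdr.ne', le_div_iff₀ hdr]
  linarith

/-- `|t_{π(j)} − (j+1)/d| ≤ ε` (the two pinnings combined; `1 ≤ d`). [folklore] -/
theorem abs_orderStat_sub_le (t : Fin d → ℝ) (ht0 : ∀ s, 0 ≤ t s) (ht1 : ∀ s, t s ≤ 1) {ε : ℝ}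
    (hε : boxDiscrepancy t ≤ ε) (j : Fin d) :
    |t (Tuple.sort t j) - ((j : ℕ) + 1 : ℝ) / d| ≤ ε := by
  have hd : 0 < d := Fin.pos j
  have hdr : (0 : ℝ) < d := by exact_mod_cast hd
  have h1 := orderStat_ge t ht0 ht1 hε j
  have h2 := orderStat_le t ht0 ht1 hε j
  have h3 : ((j : ℕ) : ℝ) / d ≤ ((j : ℕ) + 1 : ℝ) / d := by gcongr; linarith
  rw [abs_le]; constructor <;> linarith

/-- **Partial sums over rank windows** (CDT eq. (6.12) in normalised form): for any set `S` of
ranks, `|Σ_{j∈S} t_{π(j)} − Σ_{j∈S} (j+1)/d| ≤ ε · #S`.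
[cite: CalegariDimitrovTang2024, §6.2 Corollary 62 eq. (6.12) (p. 50)] -/
theorem abs_sum_orderStat_sub_le (t : Fin d → ℝ) (ht0 : ∀ s, 0 ≤ t s) (ht1 : ∀ s, t s ≤ 1)
    {ε : ℝ} (hε : boxDiscrepancy t ≤ ε) (S : Finset (Fin d)) :
    |∑ j ∈ S, t (Tuple.sort t j) - ∑ j ∈ S, ((j : ℕ) + 1 : ℝ) / d| ≤ ε * S.card := by
  rw [← Finset.sum_sub_distrib]
  calc |∑ j ∈ S, (t (Tuple.sort t j) - ((j : ℕ) + 1 : ℝ) / d)|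
      ≤ ∑ j ∈ S, |t (Tuple.sort t j) - ((j : ℕ) + 1 : ℝ) / d| := Finset.abs_sum_le_sum_abs _ _
    _ ≤ ∑ _j ∈ S, ε := Finset.sum_le_sum fun j _ => abs_orderStat_sub_le t ht0 ht1 hε j
    _ = ε * S.card := by rw [Finset.sum_const, nsmul_eq_mul, mul_comm]

/-- `Σ_{j<d} (j+1)/d = (d+1)/2`. [folklore] -/
theorem sum_rank_div (hd : 0 < d) : ∑ j : Fin d, ((j : ℕ) + 1 : ℝ) / d = ((d : ℝ) + 1) / 2 := by
  have hdr : (d : ℝ) ≠ 0 := by exact_mod_cast hd.ne'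
  rw [← Finset.sum_div, div_eq_div_iff hdr two_ne_zero]
  have h : ∑ j : Fin d, ((j : ℕ) + 1 : ℝ) = ∑ i ∈ Finset.range d, ((i : ℝ) + 1) :=
    Fin.sum_univ_eq_sum_range (fun i => (i : ℝ) + 1) d
  rw [h]
  have h2 : ∀ n : ℕ, (∑ i ∈ Finset.range n, ((i : ℝ) + 1)) * 2 = ((n : ℝ) + 1) * n := by
    intro n
    induction n with
    | zero => simp
    | succ n ih => rw [Finset.sum_range_succ, add_mul, ih]; push_cast; ring
  exact h2 d

/-- **The total sum is pinned** (normalised form of the implication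
`𝐭 ∈ P_ε^d ⟹ Σ_j t_j ∈ [d/2 − εd, d/2 + εd]` in the proof of eq. (6.9)):
`|Σ_j t_j − (d+1)/2| ≤ ε d`. [cite: CalegariDimitrovTang2024, §6.2 proof of Corollary 62
(p. 50)] -/
theorem abs_sum_sub_half_le (t : Fin d → ℝ) (ht0 : ∀ s, 0 ≤ t s) (ht1 : ∀ s, t s ≤ 1)
    {ε : ℝ} (hε : boxDiscrepancy t ≤ ε) (hd : 0 < d) :
    |∑ s, t s - ((d : ℝ) + 1) / 2| ≤ ε * d := by
  have h1 : ∑ s, t s = ∑ j, t (Tuple.sort t j) :=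
    (Equiv.sum_comp (Tuple.sort t) t).symm
  have h2 := abs_sum_orderStat_sub_le t ht0 ht1 hε Finset.univ
  rw [sum_rank_div hd, Finset.card_univ, Fintype.card_fin] at h2
  rwa [h1]

end Discrepancy

end Literature.NumberTheory.DiophantineApproximation
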